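import Summits.CriticalPhenomena.PercolationContinuityZ3.Theorems.PercNearOneGluingNoHeavyLowerTailAntipodalR1TwoCut
import HarnessLib

/-!
# ANTI₁ across a 2-separation, IV: loops, and blocks hanging at a cut vertex

Support file for `stmt-CriticalPhenomena-4575` (memo `prim-gen-kcluster/KCLUSTER-gen76.md` §2,
`KCLUSTER-gen73.md` §1.8 (A); conjecture ANTI₁ of `KCLUSTER-gen52.md` §3).  No definitions, no named
facts, no sorries.  Vocabulary of `AntipodalR1` (`clus`, `region`, `lSet`, `rSet`; gen 62) and parts
I–III (gen 78).

* `mem_clus_loops_iff`, `mem_region_loops_iff`, `mem_lSet_loops_iff`, `mem_rSet_loops_iff`,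
  `filter_lSet_loops_eq`, `filter_rSet_loops_eq` — adjoining a bunch of LOOPS `fun _ : κ => s(h, h)` to
  a system changes neither clusters nor regions, hence neither side of ANTI₁ (fibrewise).
* **Corollary** (`card_lSet_le_card_rSet_of_cutVertex`, the 1-sum reduction with the terminals on one
  side): if `G = G₁ ∪ G₂` where every vertex met by edges of both sides is the single vertex `h`, and
  `a, b, c` are met by edges of `G₂` only at `h`, then ANTI₁ for `G₁` implies ANTI₁ for `G`.  This is the
  case `u = v = h` of the 2-cut reduction `card_lSet_le_card_rSet_of_twoCut` (part III), whose two gadget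
  hypotheses become statements about `G₁` plus loops at `h`.  [this work]
-/

namespace Summit.CriticalPhenomena.PercolationContinuityZ3.Theorems

namespace AntipodalR1

open Finset Relation

variable {V ι₁ ι₂ κ : Type*}

section Loops

variable {ends₁ : ι₁ → Sym2 V} {h a : V} {ω : ι₁ ⊕ κ → Bool}

/-- Loops do not change clusters. [this work] -/
theorem mem_clus_loops_iff {col : Bool} {x : V} :
    x ∈ clus (Sum.elim ends₁ (fun _ : κ => s(h, h))) ω col a ↔
      x ∈ clus ends₁ (fun i => ω (Sum.inl i)) col a := by
  constructor
  · intro hx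
    rw [mem_clus] at hx ⊢
    induction hx with
    | refl => exact ReflTransGen.refl
    | @tail p q _ hpq ih =>
      rcases mem_nbr_sum_elim.1 hpq with h1 | ⟨k, _, hends⟩
      · exact ih.tail h1
      · have hends' : s(h, h) = s(p, q) := hends
        have hpq' : p = q := by
          rcases Sym2.eq_iff.1 hends' with ⟨hp, hq⟩ | ⟨hq, hp⟩
          · exact hp.symm.trans hq
          · exact hp.symm.trans hq
        rw [← hpq']
        exact ih
  · exact fun hx => clus_inl_subset hx

/-- Loops do not change regions. [this work] -/
theorem mem_region_loops_iff {b x : V} :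
    x ∈ region (Sum.elim ends₁ (fun _ : κ => s(h, h))) ω a b ↔
      x ∈ region ends₁ (fun i => ω (Sum.inl i)) a b := by
  rw [mem_region, mem_region]
  constructor
  · intro hx
    induction hx with
    | refl => exact ReflTransGen.refl
    | @tail p q _ hpq ih =>
      obtain ⟨⟨e, he⟩, hpK, hqK⟩ := hpq
      cases e with
      | inl i =>
        exact ih.tail ⟨⟨i, he⟩, fun h' => hpK (mem_clus_loops_iff.2 h'),
          fun h' => hqK (mem_clus_loops_iff.2 h')⟩
      | inr k =>
        have hends' : s(h, h) = s(p, q) := he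
        have hpq' : p = q := by
          rcases Sym2.eq_iff.1 hends' with ⟨hp, hq⟩ | ⟨hq, hp⟩
          · exact hp.symm.trans hq
          · exact hp.symm.trans hq
        rw [← hpq']
        exact ih
  · intro hx
    induction hx with
    | refl => exact ReflTransGen.refl
    | tail _ hpq ih =>
      obtain ⟨⟨i, he⟩, hpK, hqK⟩ := hpq
      exact ih.tail ⟨⟨Sum.inl i, he⟩, fun h' => hpK (mem_clus_loops_iff.1 h'),
        fun h' => hqK (mem_clus_loops_iff.1 h')⟩

variable [Fintype ι₁] [DecidableEq ι₁] [Fintype κ] [DecidableEq κ]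

/-- Loops do not change membership in `L`. [this work] -/
theorem mem_lSet_loops_iff {b c : V} :
    ω ∈ lSet (Sum.elim ends₁ (fun _ : κ => s(h, h))) a b c ↔
      (fun i => ω (Sum.inl i)) ∈ lSet ends₁ a b c := by
  classical
  simp only [lSet, mem_filter, mem_univ, true_and]
  rw [mem_clus_loops_iff, mem_clus_loops_iff, mem_clus_loops_iff, mem_clus_loops_iff,
    mem_region_loops_iff]

/-- Loops do not change membership in `R`. [this work] -/
theorem mem_rSet_loops_iff {b c : V} :
    ω ∈ rSet (Sum.elim ends₁ (fun _ : κ => s(h, h))) a b c ↔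
      (fun i => ω (Sum.inl i)) ∈ rSet ends₁ a b c := by
  classical
  simp only [rSet, mem_filter, mem_univ, true_and]
  rw [mem_clus_loops_iff, mem_clus_loops_iff, mem_clus_loops_iff, mem_clus_loops_iff]

end Loops

section LoopFibres

variable {ends₁ : ι₁ → Sym2 V} {h a b c : V}
variable [Fintype ι₁] [DecidableEq ι₁] [Fintype κ] [DecidableEq κ]

/-- Every `L`-fibre of "`G₁` plus loops" is `L(G₁)`. [this work] -/
theorem filter_lSet_loops_eq (g : κ → Bool) :
    (univ.filter fun ω₁ : ι₁ → Bool =>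
      Sum.elim ω₁ g ∈ lSet (Sum.elim ends₁ (fun _ : κ => s(h, h))) a b c) = lSet ends₁ a b c := by
  classical
  ext ω₁
  simp only [mem_filter, mem_univ, true_and]
  exact mem_lSet_loops_iff

/-- Every `R`-fibre of "`G₁` plus loops" is `R(G₁)`. [this work] -/
theorem filter_rSet_loops_eq (g : κ → Bool) :
    (univ.filter fun ω₁ : ι₁ → Bool =>
      Sum.elim ω₁ g ∈ rSet (Sum.elim ends₁ (fun _ : κ => s(h, h))) a b c) = rSet ends₁ a b c := by
  classical
  ext ω₁
  simp only [mem_filter, mem_univ, true_and]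
  exact mem_rSet_loops_iff

end LoopFibres

section CutVertex

variable [Fintype ι₁] [DecidableEq ι₁] [Fintype ι₂] [DecidableEq ι₂]

/-- **The 1-sum reduction, terminals on one side** (memo `KCLUSTER-gen73` §1.8 (A), kernel form).
Let `G = G₁ ∪ G₂` where every vertex met by an edge of `G₁` and by an edge of `G₂` is the vertex `h`,
and the apex `a` and the terminals `b, c` are met by edges of `G₂` only if equal to `h`.  Then ANTI₁
for `G₁` implies ANTI₁ for `G`.  No hypothesis on `G₂`. [this work] -/
theorem card_lSet_le_card_rSet_of_cutVertex (ends₁ : ι₁ → Sym2 V) (ends₂ : ι₂ → Sym2 V)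
    (h a b c : V)
    (hsep : ∀ w i, w ∈ ends₁ i → ∀ j, w ∈ ends₂ j → w = h)
    (ha : ∀ j, a ∈ ends₂ j → a = h) (hb : ∀ j, b ∈ ends₂ j → b = h)
    (hc : ∀ j, c ∈ ends₂ j → c = h)
    (h0 : (lSet ends₁ a b c).card ≤ (rSet ends₁ a b c).card) :
    (lSet (Sum.elim ends₁ ends₂) a b c).card ≤ (rSet (Sum.elim ends₁ ends₂) a b c).card := by
  classical
  refine card_lSet_le_card_rSet_of_twoCut ends₁ ends₂ h h a b c
    (fun w i hw j hj => Or.inl (hsep w i hw j hj)) (fun j hj => Or.inl (ha j hj))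
    (fun j hj => Or.inl (hb j hj)) (fun j hj => Or.inl (hc j hj)) h0 ?_ ?_
  · rw [card_eq_card_fibre_true_add_false (lSet _ a b c),
      card_eq_card_fibre_true_add_false (rSet _ a b c), filter_lSet_loops_eq, filter_lSet_loops_eq,
      filter_rSet_loops_eq, filter_rSet_loops_eq]
    exact Nat.add_le_add h0 h0
  · rw [filter_lSet_loops_eq, filter_rSet_loops_eq]
    exact h0

end CutVertex

end AntipodalR1

end Summit.CriticalPhenomena.PercolationContinuityZ3.Theorems
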